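import Literature.NumberTheory.GaloisRepresentations.ExtendedAdequateSubgroup
import Literature.NumberTheory.GaloisRepresentations.ResidualGaloisRep
import HarnessLib

/-!
# Weak adequacy in low degree (Guralnick–Herzig–Tiep 2015, Theorem 1.2) — named fact

Topic `RepresentationTheory/FiniteGroups`.  R. M. Guralnick, F. Herzig, P. H. Tiep, *Adequate groups of low degree*,
Algebra & Number Theory **9** (2015) 77–147 = arXiv:1311.1786 (bib `GuralnickHerzigTiep2015`), Theorem 1.2, as printed
(arXiv p. 3):

> **Theorem 1.2.** Let `k` be a field of characteristic `p` and `G` a finite group. Let `V` be an absolutely irreducible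
> faithful `kG`-module. Let `G⁺` denote the subgroup generated by the `p`-elements of `G`. If `p > dim W` for an
> irreducible `kG⁺`-submodule `W` of `V`, then `(G,V)` is weakly adequate.

with, on the same page: "Following [G2], we say that the representation `ρ : G → GL(V)`, respectively the pair `(G,V)`, is
*weakly adequate* if `End(V)` is spanned by the elements `ρ(g)` with `ρ(g)` semisimple."

## What is typed

The SPECIAL CASE `dim V < p` (then every irreducible `kG⁺`-submodule `W ⊆ V` has `dim W ≤ dim V < p`, and an irreducible
`kG⁺`-submodule exists because `V ≠ 0`): for a finite subgroup `H ≤ GL_n(k)` — the faithful module being `V = kⁿ` — which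
acts absolutely irreducibly (`IsAbsIrreducible H.subtype`, the tree's notion of `ResidualGaloisRep.lean`) and with `n < p`,
the semisimple elements of `H` span `M_n(k)`: `Subgroup.semisimpleSpan H = ⊤` (the tree's `𝓜 = ⟨h ∈ H | h semisimple⟩_k` of
`ExtendedAdequateSubgroup.lean`, "semisimple" in the GHTT sense *of order prime to `p`*, which for elements of finite order
in characteristic `p` is the same as diagonalisable over `k̄`).  This is the form consumed by the small-prime rows
`n < ℓ < 2(n+1)` of the adequacy dials of route `Langlands/CoreAdequacySplit` (clause (iii) of extended adequacy is then
automatic, so Thorne-adequacy there is a purely cohomological condition).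

Statement only (D-0014 named fact, `kind = definition`); the printed proof rests on the structure theory of finite linear
groups with a low-dimensional `G⁺`-constituent ([GHT 2015, §2], after Blau–Zhang) and case-by-case verification for
Chevalley groups (§§3–6); no discharge is attempted.

-- TODO(general form): the printed hypothesis is `p > dim W` for ONE irreducible `kG⁺`-submodule `W` of `V`
-- (`G⁺ = ⟨p-elements⟩`), with `dim V` arbitrary; typing it needs `G⁺` and irreducible `kG⁺`-submodules
-- (cf. the TODO list of `GuralnickHerzigTiepAdequacy.lean`).

## References

* [GuralnickHerzigTiep2015] R. M. Guralnick, F. Herzig, P. H. Tiep, *Adequate groups of low degree*, Algebra Number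
  Theory 9 (2015) 77–147; arXiv:1311.1786, Thm. 1.2 (p. 3) (read 2026-08-30, corpus `paper:arxiv-1311.1786` p. 3).
* [GuralnickHerzigTiep2017] JEMS 19 (2017), §1 — the extended notion of adequacy whose clause (iii) is weak adequacy
  (tree: `Subgroup.IsExtendedAdequate`, `Subgroup.semisimpleSpan`).
-/

namespace Literature.RepresentationTheory.FiniteGroups

open scoped MatrixGroups
open Literature.NumberTheory.GaloisRepresentations

/-- **Guralnick–Herzig–Tiep 2015, Theorem 1.2, special case `dim V < p`** ("Let `k` be a field of characteristic `p` and
`G` a finite group. Let `V` be an absolutely irreducible faithful `kG`-module. Let `G⁺` denote the subgroup generated by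
the `p`-elements of `G`. If `p > dim W` for an irreducible `kG⁺`-submodule `W` of `V`, then `(G,V)` is weakly adequate" —
here with `dim V < p`, so that the hypothesis holds for every irreducible `kG⁺`-submodule `W`).  Rendering: a finite
`H ≤ GL_n(k)`, `char k = p`, acting absolutely irreducibly on `kⁿ`, with `n < p`, has `Subgroup.semisimpleSpan H = ⊤`
("weakly adequate": `M_n(k)` is the `k`-span of the elements of `H` of order prime to `p`).
[cite: GuralnickHerzigTiep2015, Thm. 1.2 (arXiv p. 3)] -/
def GuralnickHerzigTiep2015_thm_1_2_of_lt : Prop :=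
  ∀ (k : Type) [Field k] (p : ℕ) [Fact p.Prime] [CharP k p] (n : ℕ) (H : Subgroup (GL (Fin n) k)),
    Finite H → IsAbsIrreducible H.subtype → n < p → Subgroup.semisimpleSpan H = ⊤

end Literature.RepresentationTheory.FiniteGroups
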